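import Summits.HodgeConjecture.HodgeConjecture.Cruxes.H413.Lines.R90_S6_StableTFSpectralB   -- FILE B ED. 1 (tree cebf5c78be6e ∕ 866dde8d92c2553e, BUILT BW162): the (14.5.1) engine core E1–E6

/-!
# R90 · S6 «Ch. 14.1–14.5 stable trace formula» — FILE C (ED. 2a): REDUCTION OF THE DICHOTOMY TO «GOOD» (FACTORISABLE) TRANSFERS
[Rogawski1990, §14.5 pp. 238–241; Thm. 10.3.1 (b) p. 159]

R90-TF slab, section S6 (base `R90-C14`), typist `R90-C14-typ2 (g0)`; dealt BY NAME by the section planner `R90-C14-plan (g0)` (S6 FILE C DEAL ED. 2a,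
R90 bus 15:40:41Z: «typable NOW, no `ov_cm` needed; imports B only; 0 sorry»); audit `R90-C14-audit1 (g0)` (the splice is audit1's Q3 answer of AUDIT S6#B 15:27:41Z).

HONEST LABEL: HC_CM is proved only modulo the 7 printed citations (2 remaining named inputs: hLiu418 = stmt-HodgeConjecture-24832,
h413 = stmt-HodgeConjecture-24833) until rung 0 closes.  This file is count-neutral: 0 sockets, 0 sorry; it closes nothing.

PRINT LEDGER.  Thm. 14.5.1 p. 238 is stated for `f′ = Π f′_v` and its transfers `f = Π f_v`, `f′^H = Π f′^H_v` — FACTORISABLE functions — and the measure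
comparison of p. 241 l. 9–18 («the left side defines a discrete measure … the right side a continuous measure … both sides vanish») is run by varying ONE
unramified inert component through the spherical Hecke algebra (§10.3 p. 159).  FILE B's hypothesis `MDichotomy 𝔨 SG SH MB` asks the dichotomy through EVERY
smooth matching triple `(f′, f, f^H)`, factorisable or not (the (T)-row junction quantifies over all of them).  The passage from «good» triples to all
triples is STABILITY [Thm. 10.3.1 (b) p. 159: «if all stable orbital integrals of f vanish then Sθ_G(f) = 0», and its `U(2) × U(1)` analogue]: on two matchings
`(f₁, f₁^H)`, `(f₂, f₂^H)` of the same `f′` the stable sums `SG + ½ SH` agree, and so do the M-brackets (for the kit's `SJ` totals this is ★ T1b: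
`J_{G′}(f′)` pins `SJ_G(f) + ½ SJ_H(f^H)`).  Hence a Hecke variation through a good matching `(f₁, f₁^H)` RE-BASES to one through `(f, f^H)` by changing the
family only at the base point — the two functionals along the family are unchanged.

WHAT THIS FILE TYPES (texts = `def … : Prop` with parameters, nothing asserted; heads PROVED; 0 sorry):
* (C1) `MDichotomyOn 𝔨 SG SH MB P` — B's `MDichotomy` body with the extra guard `P f' f fH →` (dichotomy asked only on «good» triples; at ED. 2b
  `P :=` S8's «`(f, f^H)` factorisable at an inert unramified `w` through the Hecke algebra» predicate).
* (C2) `StableSumOfMatching 𝔨 SG SH` («the stable sum is a function of `f′` on smooth matching triples» = Thm. 10.3.1 (b) + its `H`-analogue, kit currency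
  only), `MBOfMatching 𝔨 MB` (same for the M-bracket) and the PROVED corollary `mbOfMatching_of_stableSum : T1b → StableSum → StableSumOfMatching → MBOfMatching`.
* (C3) `GoodTransferExists 𝔨 P` (every smooth `f′` with a matching pair has a GOOD matching pair) [§14.2 (14.2.1) p. 233; §4.9; FL (b) ★ `stub_N7`].
* (C4) the re-basing `HeckeVariation.rebase` (+ `rfl` field lemmas) and PROVED `mDichotomy_of_on : StableSumOfMatching → MBOfMatching → GoodTransferExists P →
  MDichotomyOn … P → MDichotomy` (audit1's splice: `fam φ := if φ = φ₀ then f else fam₁ φ`).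
* (C5) at the Sθ-currency of record `ov : SpecOverride L`: `mBracketOv ov` (the T1d bracket as a function), `MDichotomyOnOv 𝔨 ov P` and PROVED
  `heckeDichotomyOv_of_on` ∕ `heckeDichotomyOv_of_on_of_T1b` (the latter needs only `StableSumOfMatching` + FILE A's guarded T1c text INLINE + T1b, by
  `mbOfMatching_of_stableSum`).
ED. 2b (waits on S8-A `ov_cm` + S8's factorisability predicate `P_fact`): THE (14.5.1) socket becomes `sock_S6_heckeDichotomyOn_cm : «P» → MDichotomyOnOv 𝔨 ov_cm P_fact`
+ `sock_S6_stableSumOfMatching_cm` (Thm. 10.3.1 (b)) + `sock_S6_goodTransfer_cm` (factorisable transfer at a.e. inert `w`; FL units ★ N7); S8 supplies the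
expansions on FACTORISABLE families only — the non-factorisable base never reaches S8 (planner 15:40:41Z).  Nothing of ED. 2b is posited here.

JUNK ∕ VACUITY (C5 (iv)): every `def` here is a hypothesis text with parameters; `HeckeVariation.rebase` is a construction from a GIVEN variation (no
existence claimed); the heads are implications.  No `instance`, no `axiom`, no `notation`; `set_option allowUnsafeReducibility` is not used (banned).
SORRY CENSUS: 0.
-/

set_option autoImplicit false
set_option linter.dupNamespace false

noncomputable section

namespace Summit.HodgeConjecture.HodgeConjecture.R90.S6

open MeasureTheory Measure NumberField IsDedekindDomain
open Literature.NumberTheory.Automorphic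
open Summit.HodgeConjecture.HodgeConjecture.Cruxes.H413.F0T1InnerFormTraceIdentity

variable {L : Type} [Field L] [NumberField L] [IsCMField L] {H : Matrix (Fin 3) (Fin 3) L}
  {μ : Measure (UnitaryGroup.cmDatum L 3 H).automorphicQuotient} [(UnitaryGroup.cmDatum L 3 H).IsAutomorphicMeasure μ]

/-! ## §C1 The dichotomy on «good» triples only [§14.5 p. 238 «f = Π f_v», p. 241] -/

/-- **(C1) the M-dichotomy asked only on GOOD matching triples** [Rogawski1990, §14.5 p. 238 (Thm. 14.5.1 is stated for factorisable `f′ = Π f′_v`,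
`f = Π f_v`, `f′^H = Π f′^H_v`), p. 241 l. 9–18]: FILE B's `MDichotomy 𝔨 SG SH MB` body with the extra guard `P f' f fH →`.  At ED. 2b `P :=` S8's
factorisability-at-an-inert-unramified-place predicate.  Hypothesis text; nothing asserted.  (print: Rogawski1990, §14.5 pp. 238, 241) -/
def MDichotomyOn (𝔨 : ComparisonKit L H μ) (SG : TestG L → ℂ) (SH : TestH L → ℂ) (MB : TestG L → TestH L → ℂ)
    (P : TestGp L H → TestG L → TestH L → Prop) : Prop :=
  ∀ (f' : TestGp L H) (f : TestG L) (fH : TestH L), 𝔨.Smooth f' → 𝔨.Matches f' f fH → P f' f fH →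
    ∃ V : HeckeVariation 𝔨 f' f fH,
      HeckeDiscrete V.X V.ev (fun φ => 𝔨.traceGp (V.fam' φ) - (SG (V.fam φ) + (1 / 2 : ℂ) * SH (V.famH φ))) ∧
      HeckeContinuous V.X V.ev (fun φ => MB (V.fam φ) (V.famH φ))

/-- `MDichotomy` is `MDichotomyOn` with the trivial guard. (print: Rogawski1990, §14.5 p. 241) -/
theorem mDichotomyOn_true_iff (𝔨 : ComparisonKit L H μ) (SG : TestG L → ℂ) (SH : TestH L → ℂ) (MB : TestG L → TestH L → ℂ) :
    MDichotomyOn 𝔨 SG SH MB (fun _ _ _ => True) ↔ MDichotomy 𝔨 SG SH MB :=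
  ⟨fun h f' f fH hs hm => h f' f fH hs hm trivial, fun h f' f fH hs hm _ => h f' f fH hs hm⟩

/-! ## §C2 Stability: the stable sum and the M-bracket are functions of `f′` on matching triples [Thm. 10.3.1 (b) p. 159] -/

/-- **(C2) [Rogawski1990, Thm. 10.3.1 (b) p. 159 «if all stable orbital integrals of f vanish then Sθ_G(f) = 0»; its `U(2) × U(1)` analogue; §14.5 p. 240]**
the stable sum `SG f + ½ SH f^H` takes the same value on any two matching pairs `(f₁, f₁^H)`, `(f₂, f₂^H)` of the same smooth `f′` (kit currency only:
`𝔨.Matches` fixes the stable orbital integrals).  Hypothesis text; at the Sθ-record of S8 it is the ED. 2b socket `sock_S6_stableSumOfMatching_cm`.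
(print: Rogawski1990, Thm. 10.3.1 (b) p. 159; §14.5 p. 240) -/
def StableSumOfMatching (𝔨 : ComparisonKit L H μ) (SG : TestG L → ℂ) (SH : TestH L → ℂ) : Prop :=
  ∀ (f' : TestGp L H) (f₁ f₂ : TestG L) (fH₁ fH₂ : TestH L), 𝔨.Smooth f' → 𝔨.Matches f' f₁ fH₁ → 𝔨.Matches f' f₂ fH₂ →
    SG f₁ + (1 / 2 : ℂ) * SH fH₁ = SG f₂ + (1 / 2 : ℂ) * SH fH₂

/-- **(C2′) [Rogawski1990, §14.5 (14.5.1) p. 241; Thm. 10.3.1 (b) p. 159]** the M-bracket `MB f f^H` takes the same value on any two matching pairs of the same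
smooth `f′`.  Hypothesis text; at the Sθ-record it FOLLOWS from `StableSum` + `StableSumOfMatching` + T1b (`mbOfMatching_of_stableSum`).
(print: Rogawski1990, §14.5 (14.5.1) p. 241) -/
def MBOfMatching (𝔨 : ComparisonKit L H μ) (MB : TestG L → TestH L → ℂ) : Prop :=
  ∀ (f' : TestGp L H) (f₁ f₂ : TestG L) (fH₁ fH₂ : TestH L), 𝔨.Smooth f' → 𝔨.Matches f' f₁ fH₁ → 𝔨.Matches f' f₂ fH₂ →
    MB f₁ fH₁ = MB f₂ fH₂

/-- **[Rogawski1990, §14.5 pp. 240–241; Thm. 14.4.2]** At a record satisfying the summed stabilised trace formulas (`StableSum`), stability of the stable sum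
(`StableSumOfMatching`) and the elliptic stabilisation T1b (`J_{G′}(f′) = SJ_G(f) + ½ SJ_H(f^H)`, so the `SJ`-total is a function of `f′`) force the
M-bracket to be a function of `f′` on matching triples.  (print: Rogawski1990, §14.5 pp. 240–241) -/
theorem mbOfMatching_of_stableSum (𝔨 : ComparisonKit L H μ) (hb : 𝔨.EllipticStabilisation)
    {SG : TestG L → ℂ} {SH : TestH L → ℂ} {MB : TestG L → TestH L → ℂ}
    (hc : StableSum 𝔨 SG SH MB) (hS : StableSumOfMatching 𝔨 SG SH) : MBOfMatching 𝔨 MB := by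
  intro f' f₁ f₂ fH₁ fH₂ hs hm₁ hm₂
  have h₁ : 𝔨.JGp f' = 𝔨.SJGtot f₁ + (1 / 2 : ℂ) * 𝔨.SJHtot fH₁ := (hb _ _ _ hm₁).2
  have h₂ : 𝔨.JGp f' = 𝔨.SJGtot f₂ + (1 / 2 : ℂ) * 𝔨.SJHtot fH₂ := (hb _ _ _ hm₂).2
  have e₁ := hc f' f₁ fH₁ hs hm₁
  have e₂ := hc f' f₂ fH₂ hs hm₂
  have e₃ := hS f' f₁ f₂ fH₁ fH₂ hs hm₁ hm₂
  linear_combination e₂ - e₁ - e₃ - h₁ + h₂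

/-! ## §C3 Existence of a GOOD transfer [§14.2 (14.2.1) p. 233; §4.9; FL (b)] -/

/-- **(C3) [Rogawski1990, §14.2 (14.2.1) p. 233; §4.9; §14.5 p. 238]** every smooth `f′` admitting a matching pair admits a GOOD matching pair
`(f₁, f₁^H)` (one satisfying `P f′ f₁ f₁^H`).  Hypothesis text; at ED. 2b (with `P :=` factorisable at an a.e. inert unramified `w`) it is the socket
`sock_S6_goodTransfer_cm` (local transfer place by place + the fundamental lemma for units ★ `stub_N7`).  (print: Rogawski1990, §14.2 p. 233; §14.5 p. 238) -/
def GoodTransferExists (𝔨 : ComparisonKit L H μ) (P : TestGp L H → TestG L → TestH L → Prop) : Prop :=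
  ∀ (f' : TestGp L H) (f : TestG L) (fH : TestH L), 𝔨.Smooth f' → 𝔨.Matches f' f fH →
    ∃ (f₁ : TestG L) (fH₁ : TestH L), 𝔨.Matches f' f₁ fH₁ ∧ P f' f₁ fH₁

/-! ## §C4 Re-basing a Hecke variation and the reduction `MDichotomyOn P → MDichotomy` [p. 241; Thm. 10.3.1 (b) p. 159] -/

/-- **Re-basing a Hecke variation** [Rogawski1990, §14.5 p. 241; §10.3 p. 159]: from a variation `V₁` through `(f′, f₁, f₁^H)` and another matching pair
`(f, f^H)` of the same `f′`, the variation through `(f′, f, f^H)` with the SAME `G′`-family, chart and evaluation, whose `G`∕`H`-families are changed only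
at the base point: `fam := Function.update V₁.fam φ₀ f` («`if φ = φ₀ then f else V₁.fam φ`», audit1's splice, AUDIT S6#B Q3).  A construction from GIVEN
data; no existence claimed.
(print: Rogawski1990, §14.5 p. 241) -/
def HeckeVariation.rebase {𝔨 : ComparisonKit L H μ} {f' : TestGp L H} {f₁ : TestG L} {fH₁ : TestH L}
    (V₁ : HeckeVariation 𝔨 f' f₁ fH₁) [DecidableEq V₁.Φ] (f : TestG L) (fH : TestH L) (hm : 𝔨.Matches f' f fH) :
    HeckeVariation 𝔨 f' f fH where
  Φ := V₁.Φ
  φ₀ := V₁.φ₀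
  fam' := V₁.fam'
  fam := Function.update V₁.fam V₁.φ₀ f
  famH := Function.update V₁.famH V₁.φ₀ fH
  base := ⟨V₁.base.1, Function.update_self V₁.φ₀ f V₁.fam, Function.update_self V₁.φ₀ fH V₁.famH⟩
  smooth := V₁.smooth
  matching φ := by
    by_cases h : φ = V₁.φ₀
    · rw [h, Function.update_self, Function.update_self, V₁.base.1]
      exact hm
    · rw [Function.update_of_ne h, Function.update_of_ne h]
      exact V₁.matching φ
  X := V₁.X
  ev := V₁.ev
  dense := V₁.dense

section Rebase

variable {𝔨 : ComparisonKit L H μ} {f' : TestGp L H} {f₁ : TestG L} {fH₁ : TestH L}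
  (V₁ : HeckeVariation 𝔨 f' f₁ fH₁) [DecidableEq V₁.Φ] (f : TestG L) (fH : TestH L) (hm : 𝔨.Matches f' f fH)

/-- (field lemma) [cite: Rogawski1990, §14.5 p. 241] -/
theorem HeckeVariation.rebase_Φ : (V₁.rebase f fH hm).Φ = V₁.Φ := rfl
/-- (field lemma) [cite: Rogawski1990, §14.5 p. 241] -/
theorem HeckeVariation.rebase_φ₀ : (V₁.rebase f fH hm).φ₀ = V₁.φ₀ := rfl
/-- (field lemma) [cite: Rogawski1990, §14.5 p. 241] -/
theorem HeckeVariation.rebase_fam' (φ : V₁.Φ) : (V₁.rebase f fH hm).fam' φ = V₁.fam' φ := rfl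
/-- (field lemma) [cite: Rogawski1990, §14.5 p. 241] -/
theorem HeckeVariation.rebase_fam : (V₁.rebase f fH hm).fam = Function.update V₁.fam V₁.φ₀ f := rfl
/-- (field lemma) [cite: Rogawski1990, §14.5 p. 241] -/
theorem HeckeVariation.rebase_famH : (V₁.rebase f fH hm).famH = Function.update V₁.famH V₁.φ₀ fH := rfl
/-- (field lemma: the base point is moved to `f`) [cite: Rogawski1990, §14.5 p. 241] -/
theorem HeckeVariation.rebase_fam_base : (V₁.rebase f fH hm).fam V₁.φ₀ = f := by
  rw [HeckeVariation.rebase_fam]; exact Function.update_self V₁.φ₀ f V₁.fam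
/-- (field lemma) [cite: Rogawski1990, §14.5 p. 241] -/
theorem HeckeVariation.rebase_famH_base : (V₁.rebase f fH hm).famH V₁.φ₀ = fH := by
  rw [HeckeVariation.rebase_famH]; exact Function.update_self V₁.φ₀ fH V₁.famH
/-- (field lemma: away from the base point nothing changes) [cite: Rogawski1990, §14.5 p. 241] -/
theorem HeckeVariation.rebase_fam_of_ne {φ : V₁.Φ} (h : φ ≠ V₁.φ₀) : (V₁.rebase f fH hm).fam φ = V₁.fam φ := by
  rw [HeckeVariation.rebase_fam]; exact Function.update_of_ne h f V₁.fam
/-- (field lemma) [cite: Rogawski1990, §14.5 p. 241] -/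
theorem HeckeVariation.rebase_famH_of_ne {φ : V₁.Φ} (h : φ ≠ V₁.φ₀) : (V₁.rebase f fH hm).famH φ = V₁.famH φ := by
  rw [HeckeVariation.rebase_famH]; exact Function.update_of_ne h fH V₁.famH
/-- (field lemma) [cite: Rogawski1990, §14.5 p. 241] -/
theorem HeckeVariation.rebase_X : (V₁.rebase f fH hm).X = V₁.X := rfl

end Rebase

/-- `HeckeDiscrete` only depends on the values of the functional (pointwise congruence). (print: Rogawski1990, §10.3 p. 159) -/
theorem heckeDiscrete_congr {X : TopologicalSpace.Compacts ℂ} {Φ : Type} {ev : Φ → C(X, ℂ)} {F G : Φ → ℂ} (hFG : ∀ φ, F φ = G φ)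
    (hF : HeckeDiscrete X ev F) : HeckeDiscrete X ev G := by
  obtain ⟨ι, z, c, hc, hFz⟩ := hF
  exact ⟨ι, z, c, hc, fun φ => (hFG φ) ▸ hFz φ⟩

/-- `HeckeContinuous` only depends on the values of the functional (pointwise congruence). (print: Rogawski1990, §10.3 p. 159) -/
theorem heckeContinuous_congr {X : TopologicalSpace.Compacts ℂ} {Φ : Type} {ev : Φ → C(X, ℂ)} {F G : Φ → ℂ} (hFG : ∀ φ, F φ = G φ)
    (hF : HeckeContinuous X ev F) : HeckeContinuous X ev G := by
  obtain ⟨m, d, hm0, hd, hFm⟩ := hF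
  exact ⟨m, d, hm0, hd, fun φ => (hFG φ) ▸ hFm φ⟩

/-- **(C4) REDUCTION TO GOOD TRIPLES** [Rogawski1990, §14.5 pp. 238–241; Thm. 10.3.1 (b) p. 159]: if the stable sum and the M-bracket are functions of `f′`
on matching triples, and every smooth `f′` with a matching pair has a GOOD one, then the dichotomy on good triples gives the dichotomy on ALL smooth matching
triples — re-base the good triple's variation; along the family the two functionals are unchanged (they differ at most at the base point, where
`StableSumOfMatching` ∕ `MBOfMatching` equate them).  (print: Rogawski1990, §14.5 pp. 238–241) -/
theorem mDichotomy_of_on (𝔨 : ComparisonKit L H μ) {SG : TestG L → ℂ} {SH : TestH L → ℂ} {MB : TestG L → TestH L → ℂ}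
    {P : TestGp L H → TestG L → TestH L → Prop}
    (hS : StableSumOfMatching 𝔨 SG SH) (hM : MBOfMatching 𝔨 MB) (hT : GoodTransferExists 𝔨 P) (hOn : MDichotomyOn 𝔨 SG SH MB P) :
    MDichotomy 𝔨 SG SH MB := by
  classical
  intro f' f fH hs hm
  obtain ⟨f₁, fH₁, hm₁, hP⟩ := hT f' f fH hs hm
  obtain ⟨V₁, hD, hR⟩ := hOn f' f₁ fH₁ hs hm₁ hP
  have hfam : ∀ φ : V₁.Φ, SG (V₁.fam φ) + (1 / 2 : ℂ) * SH (V₁.famH φ) =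
      SG ((V₁.rebase f fH hm).fam φ) + (1 / 2 : ℂ) * SH ((V₁.rebase f fH hm).famH φ) := by
    intro φ
    by_cases h : φ = V₁.φ₀
    · rw [h, HeckeVariation.rebase_fam_base, HeckeVariation.rebase_famH_base, V₁.base.2.1, V₁.base.2.2]
      exact hS f' f₁ f fH₁ fH hs hm₁ hm
    · rw [HeckeVariation.rebase_fam_of_ne V₁ f fH hm h, HeckeVariation.rebase_famH_of_ne V₁ f fH hm h]
  have hmb : ∀ φ : V₁.Φ, MB (V₁.fam φ) (V₁.famH φ) = MB ((V₁.rebase f fH hm).fam φ) ((V₁.rebase f fH hm).famH φ) := by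
    intro φ
    by_cases h : φ = V₁.φ₀
    · rw [h, HeckeVariation.rebase_fam_base, HeckeVariation.rebase_famH_base, V₁.base.2.1, V₁.base.2.2]
      exact hM f' f₁ f fH₁ fH hs hm₁ hm
    · rw [HeckeVariation.rebase_fam_of_ne V₁ f fH hm h, HeckeVariation.rebase_famH_of_ne V₁ f fH hm h]
  refine ⟨V₁.rebase f fH hm, ?_, ?_⟩
  · refine heckeDiscrete_congr (fun φ => ?_) hD
    show 𝔨.traceGp (V₁.fam' φ) - (SG (V₁.fam φ) + (1 / 2 : ℂ) * SH (V₁.famH φ)) =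
      𝔨.traceGp (V₁.fam' φ) - (SG ((V₁.rebase f fH hm).fam φ) + (1 / 2 : ℂ) * SH ((V₁.rebase f fH hm).famH φ))
    rw [hfam φ]
  · exact heckeContinuous_congr (fun φ => hmb φ) hR

/-! ## §C5 At the Sθ-currency of record `ov : SpecOverride L` [pp. 240–241] -/

/-- **The T1d M-bracket as a function, read at an override** [Rogawski1990, §14.5 (14.5.1) p. 241]:
`(f, f^H) ↦ [Sθ_M(f) + ½ Sθ_{M_H}(f^H)] − [SJ_M(f) + ½ SJ_{M_H}(f^H)]` (the lambda inside B's `HeckeDichotomyOv`).  (print: Rogawski1990, §14.5 (14.5.1) p. 241) -/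
def mBracketOv (ov : SpecOverride L) : TestG L → TestH L → ℂ :=
  fun f fH => (ov.SθM f + (1 / 2 : ℂ) * ov.SθMH fH) - (ov.SJM f + (1 / 2 : ℂ) * ov.SJMH fH)

/-- (pointwise) [cite: Rogawski1990, §14.5 (14.5.1) p. 241] -/
theorem mBracketOv_apply (ov : SpecOverride L) (f : TestG L) (fH : TestH L) :
    mBracketOv ov f fH = (ov.SθM f + (1 / 2 : ℂ) * ov.SθMH fH) - (ov.SJM f + (1 / 2 : ℂ) * ov.SJMH fH) := rfl

/-- B's `HeckeDichotomyOv 𝔨 ov` is `MDichotomy` at `(ov.SθG, ov.SθH, mBracketOv ov)` (by `Iff.rfl`). (print: Rogawski1990, §14.5 p. 241) -/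
theorem heckeDichotomyOv_iff_mDichotomy (𝔨 : ComparisonKit L H μ) (ov : SpecOverride L) :
    HeckeDichotomyOv 𝔨 ov ↔ MDichotomy 𝔨 ov.SθG ov.SθH (mBracketOv ov) :=
  Iff.rfl

/-- **(C5) the good-triple dichotomy READ AT AN OVERRIDE** [Rogawski1990, §14.5 pp. 238–241]: `MDichotomyOn` at `(ov.SθG, ov.SθH, mBracketOv ov, P)`.
At S8's `ov_cm` and S8's factorisability predicate this is THE printed (14.5.1) content — the ED. 2b socket `sock_S6_heckeDichotomyOn_cm`; nothing asserted here.
(print: Rogawski1990, §14.5 pp. 238–241) -/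
def MDichotomyOnOv (𝔨 : ComparisonKit L H μ) (ov : SpecOverride L) (P : TestGp L H → TestG L → TestH L → Prop) : Prop :=
  MDichotomyOn 𝔨 ov.SθG ov.SθH (mBracketOv ov) P

/-- The expanded text of `MDichotomyOnOv` (by `Iff.rfl`). (print: Rogawski1990, §14.5 p. 241) -/
theorem mDichotomyOnOv_iff (𝔨 : ComparisonKit L H μ) (ov : SpecOverride L) (P : TestGp L H → TestG L → TestH L → Prop) :
    MDichotomyOnOv 𝔨 ov P ↔
      ∀ (f' : TestGp L H) (f : TestG L) (fH : TestH L), 𝔨.Smooth f' → 𝔨.Matches f' f fH → P f' f fH →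
        ∃ V : HeckeVariation 𝔨 f' f fH,
          HeckeDiscrete V.X V.ev (fun φ => 𝔨.traceGp (V.fam' φ) - (ov.SθG (V.fam φ) + (1 / 2 : ℂ) * ov.SθH (V.famH φ))) ∧
          HeckeContinuous V.X V.ev (fun φ => mBracketOv ov (V.fam φ) (V.famH φ)) :=
  Iff.rfl

/-- **(C5) `HeckeDichotomyOv` from the good-triple dichotomy at an override** [Rogawski1990, §14.5 pp. 238–241; Thm. 10.3.1 (b) p. 159].
(print: Rogawski1990, §14.5 pp. 238–241) -/
theorem heckeDichotomyOv_of_on (𝔨 : ComparisonKit L H μ) (ov : SpecOverride L) {P : TestGp L H → TestG L → TestH L → Prop}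
    (hS : StableSumOfMatching 𝔨 ov.SθG ov.SθH) (hM : MBOfMatching 𝔨 (mBracketOv ov)) (hT : GoodTransferExists 𝔨 P)
    (hOn : MDichotomyOnOv 𝔨 ov P) : HeckeDichotomyOv 𝔨 ov :=
  mDichotomy_of_on 𝔨 hS hM hT hOn

/-- **(C5′) the same with `MBOfMatching` DISCHARGED by T1b + FILE A's guarded T1c text (INLINE, byte-for-byte) + stability of the stable sum**
[Rogawski1990, §14.5 pp. 238–241; Thm. 10.3.1 (b) p. 159]: the inputs of ED. 2b are then exactly `StableSumOfMatching` (Thm. 10.3.1 (b)), `GoodTransferExists`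
(factorisable transfer) and the good-triple dichotomy.  (print: Rogawski1990, §14.5 pp. 238–241) -/
theorem heckeDichotomyOv_of_on_of_T1b (𝔨 : ComparisonKit L H μ) (hb : 𝔨.EllipticStabilisation) (ov : SpecOverride L)
    {P : TestGp L H → TestG L → TestH L → Prop}
    (hc : ∀ (f' : TestGp L H) (f : TestG L) (fH : TestH L), 𝔨.Smooth f' → 𝔨.Matches f' f fH →
      𝔨.SJGtot f = ov.SθG f + ov.SθM f - ov.SJM f ∧ 𝔨.SJHtot fH = ov.SθH fH + ov.SθMH fH - ov.SJMH fH)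
    (hS : StableSumOfMatching 𝔨 ov.SθG ov.SθH) (hT : GoodTransferExists 𝔨 P) (hOn : MDichotomyOnOv 𝔨 ov P) :
    HeckeDichotomyOv 𝔨 ov := by
  have hsum : StableSum 𝔨 ov.SθG ov.SθH (mBracketOv ov) := by
    intro f' f fH hs hm
    obtain ⟨h3, h4⟩ := hc f' f fH hs hm
    rw [h3, h4, mBracketOv_apply]
    ring
  exact mDichotomy_of_on 𝔨 hS (mbOfMatching_of_stableSum 𝔨 hb hsum hS) hT hOn

/-- **(C5″) T1d at an override from the GOOD-TRIPLE dichotomy** [Rogawski1990, §14.5 (14.5.1) pp. 238–241]: chaining (C5′) with FILE B's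
`mTermCancellationSm_of_dichotomy_of_T1b` — hypotheses T1a, T1b, FILE A's guarded T1c text (INLINE), `StableSumOfMatching`, `GoodTransferExists P`,
`MDichotomyOnOv 𝔨 ov P`, `LanglandsDichotomy`; conclusion FILE A's guarded T1d text (INLINE, byte-for-byte).  (print: Rogawski1990, §14.5 (14.5.1) pp. 238–241) -/
theorem mTermCancellationSm_of_on_of_T1b (𝔨 : ComparisonKit L H μ) (ha : 𝔨.SimpleTraceFormula) (hb : 𝔨.EllipticStabilisation) (ov : SpecOverride L)
    {P : TestGp L H → TestG L → TestH L → Prop}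
    (hc : ∀ (f' : TestGp L H) (f : TestG L) (fH : TestH L), 𝔨.Smooth f' → 𝔨.Matches f' f fH →
      𝔨.SJGtot f = ov.SθG f + ov.SθM f - ov.SJM f ∧ 𝔨.SJHtot fH = ov.SθH fH + ov.SθMH fH - ov.SJMH fH)
    (hS : StableSumOfMatching 𝔨 ov.SθG ov.SθH) (hT : GoodTransferExists 𝔨 P) (hOn : MDichotomyOnOv 𝔨 ov P) (hL : LanglandsDichotomy) :
    ∀ (f' : TestGp L H) (f : TestG L) (fH : TestH L), 𝔨.Smooth f' → 𝔨.Matches f' f fH →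
      (ov.SθM f + (1 / 2 : ℂ) * ov.SθMH fH) - (ov.SJM f + (1 / 2 : ℂ) * ov.SJMH fH) = 0 :=
  mTermCancellationSm_of_dichotomy_of_T1b 𝔨 ha hb ov hc (heckeDichotomyOv_of_on_of_T1b 𝔨 hb ov hc hS hT hOn) hL

end Summit.HodgeConjecture.HodgeConjecture.R90.S6

end
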